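import Literature.Geometry.Riemannian.HamiltonCurvatureODE
import Literature.Geometry.Riemannian.CurvatureDecompositionProofs
import Mathlib.LinearAlgebra.Matrix.Symmetric
import Mathlib.LinearAlgebra.CrossProduct
import Mathlib.Analysis.SpecialFunctions.Trigonometric.Deriv
import Mathlib.Analysis.Calculus.LocalExtr.Basic
import HarnessLib

/-!
# Hamilton's differential inequality `d/dt (a₁ + a₂) ≥ a₁² + a₂² + 2(a₁ + a₂)a₃ + b₁² + b₂²` at a Ky Fan minimiser
(topic `Geometry/Riemannian`)

Pointwise linear algebra behind the ODE half of **Hamilton 1997, §2.1 (= Section B), Thm. 1.2**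
(Comm. Anal. Geom. 5, p. 7: "For any constant `m > 0` the Ricci flow preserves the inequalities
`a₁ + a₂ ≥ m` and `c₁ + c₂ ≥ m`. Proof. From the ordinary differential inequalities in [3]
`d/dt (a₁ + a₂) ≥ a₁² + a₂² + 2(a₁ + a₂)a₃ + b₁² + b₂²`. Now if `a₁ + a₂ ≥ m > 0` then `a₃ > 0`
also. …"), for the `A`-component `A' = A² + B ᵗB + 2A^#` of Hamilton's ODE `M' = M² + M^#` in
block form (`HamiltonODE.field`, Hamilton 1986, §6, p. 166) and the variational (Ky Fan) form
`Matrix.TwoSmallestEigenvaluesSumGE` of `a₁ + a₂ ≥ m` used by the tree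
(`PinchingEstimatesODE.lean`), in which `a₁ + a₂` is the minimum of `uᵀAu + vᵀAv` over
orthonormal pairs `(u, v)` of `ℝ³`:

* `HamiltonODE.adjugate_conj`, `HamiltonODE.conj_fieldA` — `O(3)`-equivariance of `M^#` and of
  the field: `R (A² + BᵗB + 2A^#) ᵗR = (RAᵗR)² + (RB)ᵗ(RB) + 2(RAᵗR)^#` for `R ᵗR = 1`;
* `HamiltonODE.quad_cross_eq_zero_of_min` — the first-order condition at a minimising
  orthonormal pair: Fermat's theorem for `θ ↦ (cos θ u + sin θ w)ᵀ A (cos θ u + sin θ w)`;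
* `HamiltonODE.fieldA_diag_sum_ge`, `HamiltonODE.fieldA_quadratic_ge` — **Hamilton's
  inequality**: at an orthonormal pair `(u, v)` minimising `uᵀAu + vᵀAv` (`A` symmetric) with
  nonnegative minimum, `uᵀA'u + vᵀA'v ≥ (uᵀAu + vᵀAv)²`; in the frame `(u, v, u × v)` this is
  `a₁² + a₂² + 2a₁₂² + 2(a₁ + a₂)a₃ + Σ b² ≥ (a₁ + a₂)²` with `a₃ ≥ a₁`.

The time-dependent argument (the minimum over the compact set of orthonormal pairs cannot drop
below `m` along a solution) and the consequences for the Ricci flow are in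
`PinchingEstimatesTwoSmallestSum.lean`. No definitions are introduced.

## References

* R. S. Hamilton, *Four-manifolds with positive isotropic curvature*, Comm. Anal. Geom. 5 (1997)
  1–92, §2.1, Thm. 1.2 and its proof (p. 7). [Hamilton1997]
* R. S. Hamilton, *Four-manifolds with positive curvature operator*, J. Differential Geom. 24
  (1986) 153–179, §2 (p. 157, `M^#`), §6 (p. 166, the block system). [Hamilton1986]
-/

noncomputable section

open Set Matrix
open scoped Matrix Topology

namespace Literature.Geometry.Riemannian

namespace HamiltonODE

/-! ### The `A`- and `C`-components of Hamilton's field -/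

/-- The `A`-equation of Hamilton's block system is `A' = A² + B ᵗB + 2A^#` (Hamilton 1986, §6,
p. 166): the first component of `HamiltonODE.field`. [cite: Hamilton1986, §6, p. 166] -/
theorem field_fst (p : Blocks) :
    (field p).1 = p.1 * p.1 + p.2.1 * p.2.1ᵀ + (2 : ℝ) • p.1.sharp := rfl

/-- The `C`-equation `C' = C² + ᵗB B + 2C^#` is the `A`-equation for the pair `(C, ᵗB)`
(Hamilton 1986, §6, p. 166). [cite: Hamilton1986, §6, p. 166] -/
theorem field_snd_snd (p : Blocks) :
    (field p).2.2 = p.2.2 * p.2.2 + p.2.1ᵀ * p.2.1ᵀᵀ + (2 : ℝ) • p.2.2.sharp := by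
  simp [field]

/-! ### Orthogonal conjugation -/

/-- `(R X ᵗR)ᵢⱼ = Rᵢ ⬝ X Rⱼ` (rows of `R`). [folklore] -/
theorem conj_transpose_apply (R X : Matrix (Fin 3) (Fin 3) ℝ) (i j : Fin 3) :
    (R * X * Rᵀ) i j = R i ⬝ᵥ (X *ᵥ R j) := by
  simp only [Matrix.mul_apply, Matrix.transpose_apply, dotProduct, mulVec, Fin.sum_univ_three]
  ring

/-- `R ᵗR = 1` implies `ᵗR R = 1` for square matrices. [folklore] -/
theorem transpose_mul_self_of {R : Matrix (Fin 3) (Fin 3) ℝ} (hR : R * Rᵀ = 1) : Rᵀ * R = 1 :=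
  mul_eq_one_comm.1 hR

/-- **The adjugate is `O(3)`-equivariant**: `adj(R X ᵗR) = R adj(X) ᵗR` for `R ᵗR = 1`
(`adj` is anti-multiplicative, `adj R = det R · ᵗR` and `(det R)² = 1`). [folklore] -/
theorem adjugate_conj {R : Matrix (Fin 3) (Fin 3) ℝ} (hR : R * Rᵀ = 1)
    (X : Matrix (Fin 3) (Fin 3) ℝ) : adjugate (R * X * Rᵀ) = R * adjugate X * Rᵀ := by
  have hR' : Rᵀ * R = 1 := transpose_mul_self_of hR
  have hdet : R.det * R.det = 1 := by
    have := congrArg Matrix.det hR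
    rwa [det_mul, det_transpose, det_one] at this
  have hadjR : adjugate R = R.det • Rᵀ := by
    calc adjugate R = Rᵀ * R * adjugate R := by rw [hR', Matrix.one_mul]
      _ = Rᵀ * (R.det • (1 : Matrix (Fin 3) (Fin 3) ℝ)) := by rw [Matrix.mul_assoc, mul_adjugate]
      _ = R.det • Rᵀ := by simp
  have hadjRt : adjugate Rᵀ = R.det • R := by
    rw [← adjugate_transpose, hadjR, transpose_smul, transpose_transpose]
  rw [adjugate_mul_distrib, adjugate_mul_distrib, hadjR, hadjRt]
  simp only [smul_mul_assoc, mul_smul_comm, smul_smul, hdet, one_smul, Matrix.mul_assoc]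

/-- `(R X ᵗR)^# = R X^# ᵗR` for `R ᵗR = 1`. [folklore] -/
theorem sharp_conj {R : Matrix (Fin 3) (Fin 3) ℝ} (hR : R * Rᵀ = 1) (X : Matrix (Fin 3) (Fin 3) ℝ) :
    (R * X * Rᵀ).sharp = R * X.sharp * Rᵀ := by
  simp only [Matrix.sharp]
  rw [adjugate_conj hR, transpose_mul, transpose_mul, transpose_transpose, ← Matrix.mul_assoc]

/-- **Equivariance of Hamilton's `A`-field**: `R (A² + BᵗB + 2A^#) ᵗR =
(RAᵗR)² + (RB)ᵗ(RB) + 2(RAᵗR)^#` for `R ᵗR = 1` (the block system is natural under changes of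
orthonormal basis of `Λ²₊`). [folklore] -/
theorem conj_fieldA {R : Matrix (Fin 3) (Fin 3) ℝ} (hR : R * Rᵀ = 1)
    (A B : Matrix (Fin 3) (Fin 3) ℝ) :
    R * (A * A + B * Bᵀ + (2 : ℝ) • A.sharp) * Rᵀ =
      R * A * Rᵀ * (R * A * Rᵀ) + R * B * (R * B)ᵀ + (2 : ℝ) • (R * A * Rᵀ).sharp := by
  have hR' : Rᵀ * R = 1 := transpose_mul_self_of hR
  simp only [Matrix.mul_add, Matrix.add_mul, Matrix.mul_smul, Matrix.smul_mul, sharp_conj hR,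
    transpose_mul]
  congr 2
  · calc R * (A * A) * Rᵀ = R * (A * (Rᵀ * R) * A) * Rᵀ := by rw [hR', Matrix.mul_one]
      _ = R * A * Rᵀ * (R * A * Rᵀ) := by simp only [Matrix.mul_assoc]
  · simp only [Matrix.mul_assoc]

/-- An orthonormal triple `(u, v, w)` gives an orthogonal matrix of rows: `R ᵗR = 1`. [folklore] -/
theorem frame3_mul_transpose {u v w : Fin 3 → ℝ} (hu : u ⬝ᵥ u = 1) (hv : v ⬝ᵥ v = 1)
    (hw : w ⬝ᵥ w = 1) (huv : u ⬝ᵥ v = 0) (huw : u ⬝ᵥ w = 0) (hvw : v ⬝ᵥ w = 0) :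
    Matrix.of ![u, v, w] * (Matrix.of ![u, v, w])ᵀ = 1 := by
  have hvu : v ⬝ᵥ u = 0 := by rw [dotProduct_comm]; exact huv
  have hwu : w ⬝ᵥ u = 0 := by rw [dotProduct_comm]; exact huw
  have hwv : w ⬝ᵥ v = 0 := by rw [dotProduct_comm]; exact hvw
  have r0 : Matrix.of ![u, v, w] 0 = u := rfl
  have r1 : Matrix.of ![u, v, w] 1 = v := rfl
  have r2 : Matrix.of ![u, v, w] 2 = w := rfl
  have key : ∀ i j, (Matrix.of ![u, v, w] * (Matrix.of ![u, v, w])ᵀ) i j =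
      Matrix.of ![u, v, w] i ⬝ᵥ Matrix.of ![u, v, w] j := fun i j ↦ rfl
  ext i j
  rw [key]
  fin_cases i <;> fin_cases j <;> simp [r0, r1, r2, hu, hv, hw, huv, huw, hvw, hvu, hwu, hwv]

/-! ### Symmetric matrices: Hamilton's differential inequality at a minimising pair -/

/-- For symmetric `A`, `xᵀAy = yᵀAx`. [folklore] -/
theorem quad_comm_of_isSymm {A : Matrix (Fin 3) (Fin 3) ℝ} (hA : A.IsSymm) (x y : Fin 3 → ℝ) :
    x ⬝ᵥ (A *ᵥ y) = y ⬝ᵥ (A *ᵥ x) := by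
  rw [dotProduct_mulVec, ← mulVec_transpose, hA.eq, dotProduct_comm]

/-- Conjugates `R A ᵗR` of a symmetric `A` are symmetric. [folklore] -/
theorem isSymm_conj {A : Matrix (Fin 3) (Fin 3) ℝ} (hA : A.IsSymm) (R : Matrix (Fin 3) (Fin 3) ℝ) :
    (R * A * Rᵀ).IsSymm := by
  unfold Matrix.IsSymm
  rw [transpose_mul, transpose_mul, transpose_transpose, hA.eq, Matrix.mul_assoc]

/-- **Hamilton's inequality in a normal frame** (1997, §2.1, proof of Thm. 1.2:
`d/dt (a₁ + a₂) ≥ a₁² + a₂² + 2(a₁ + a₂)a₃ + b₁² + b₂²`, and "if `a₁ + a₂ ≥ m > 0` then `a₃ > 0`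
also"): for symmetric `A` with `A₀₂ = A₁₂ = 0`, `A₀₀ ≤ A₂₂` and `A₀₀ + A₁₁ ≥ 0`,
`(A₀₀ + A₁₁)² ≤ (A')₀₀ + (A')₁₁` where `A' = A² + B ᵗB + 2A^#` (indeed
`(A')₀₀ + (A')₁₁ = A₀₀² + A₁₁² + 2A₀₁² + 2A₂₂(A₀₀ + A₁₁) + Σⱼ (B₀ⱼ² + B₁ⱼ²)`).
[cite: Hamilton1997, §2.1, proof of Thm. 1.2 (p. 7)] -/
theorem fieldA_diag_sum_ge {A B : Matrix (Fin 3) (Fin 3) ℝ} (hA : A.IsSymm) (h02 : A 0 2 = 0)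
    (h12 : A 1 2 = 0) (h0 : A 0 0 ≤ A 2 2) (hpos : 0 ≤ A 0 0 + A 1 1) :
    (A 0 0 + A 1 1) ^ 2 ≤
      (A * A + B * Bᵀ + (2 : ℝ) • A.sharp) 0 0 + (A * A + B * Bᵀ + (2 : ℝ) • A.sharp) 1 1 := by
  have h20 : A 2 0 = 0 := (hA.apply 0 2).trans h02
  have h21 : A 2 1 = 0 := (hA.apply 1 2).trans h12
  have h10 : A 1 0 = A 0 1 := hA.apply 0 1
  simp only [Matrix.sharp, Matrix.add_apply, Matrix.mul_apply, Matrix.smul_apply,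
    Matrix.transpose_apply, adjugate_fin_three, Fin.sum_univ_three, smul_eq_mul]
  simp [h02, h12, h20, h21, h10]
  nlinarith [mul_nonneg (sub_nonneg.2 h0) hpos, sq_nonneg (A 0 1), sq_nonneg (B 0 0),
    sq_nonneg (B 0 1), sq_nonneg (B 0 2), sq_nonneg (B 1 0), sq_nonneg (B 1 1), sq_nonneg (B 1 2),
    sq_nonneg (A 0 0 - A 1 1)]

/-- Rotating `u` towards `w` in an orthonormal pair `(u, w)` keeps unit length (`c² + s² = 1`).
[folklore] -/
theorem rot_dotProduct_self {u w : Fin 3 → ℝ} (hu : u ⬝ᵥ u = 1) (hw : w ⬝ᵥ w = 1)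
    (huw : u ⬝ᵥ w = 0) (c s : ℝ) (hcs : c ^ 2 + s ^ 2 = 1) :
    (c • u + s • w) ⬝ᵥ (c • u + s • w) = 1 := by
  have hwu : w ⬝ᵥ u = 0 := by rw [dotProduct_comm]; exact huw
  simp only [dotProduct_add, add_dotProduct, dotProduct_smul, smul_dotProduct, smul_eq_mul, hu, hw,
    huw, hwu]
  nlinarith [hcs]

/-- … and orthogonality to any `v ⊥ u, w`. [folklore] -/
theorem rot_dotProduct_other {u w v : Fin 3 → ℝ} (huv : u ⬝ᵥ v = 0) (hwv : w ⬝ᵥ v = 0)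
    (c s : ℝ) : (c • u + s • w) ⬝ᵥ v = 0 := by
  simp [add_dotProduct, smul_dotProduct, huv, hwv]

/-- The quadratic form of a symmetric `A` on `c u + s w`. [folklore] -/
theorem rot_quadratic {A : Matrix (Fin 3) (Fin 3) ℝ} (hA : A.IsSymm) (u w : Fin 3 → ℝ)
    (c s : ℝ) : (c • u + s • w) ⬝ᵥ (A *ᵥ (c • u + s • w)) =
      c ^ 2 * (u ⬝ᵥ (A *ᵥ u)) + 2 * (c * s) * (u ⬝ᵥ (A *ᵥ w)) + s ^ 2 * (w ⬝ᵥ (A *ᵥ w)) := by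
  have hwu : w ⬝ᵥ (A *ᵥ u) = u ⬝ᵥ (A *ᵥ w) := quad_comm_of_isSymm hA w u
  simp only [mulVec_add, mulVec_smul, dotProduct_add, dotProduct_smul, add_dotProduct,
    smul_dotProduct, smul_eq_mul, hwu]
  ring

/-- **First-order condition at a minimiser.** If the unit vector `u ⊥ v` minimises `uᵀAu`
among unit vectors orthogonal to `v` (`A` symmetric) and `w` is a unit vector orthogonal to `u`
and `v`, then `uᵀAw = 0`: Fermat's theorem (`IsLocalMin.hasDerivAt_eq_zero`) for
`θ ↦ (cos θ u + sin θ w)ᵀ A (cos θ u + sin θ w)`, whose derivative at `0` is `2uᵀAw`. [folklore] -/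
theorem quad_cross_eq_zero_of_min {A : Matrix (Fin 3) (Fin 3) ℝ} (hA : A.IsSymm)
    {u v w : Fin 3 → ℝ} (hu : u ⬝ᵥ u = 1) (hw : w ⬝ᵥ w = 1) (huw : u ⬝ᵥ w = 0)
    (huv : u ⬝ᵥ v = 0) (hwv : w ⬝ᵥ v = 0)
    (hmin : ∀ u' : Fin 3 → ℝ, u' ⬝ᵥ u' = 1 → u' ⬝ᵥ v = 0 → u ⬝ᵥ (A *ᵥ u) ≤ u' ⬝ᵥ (A *ᵥ u')) :
    u ⬝ᵥ (A *ᵥ w) = 0 := by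
  set p := u ⬝ᵥ (A *ᵥ u) with hp
  set y := u ⬝ᵥ (A *ᵥ w) with hy
  set r := w ⬝ᵥ (A *ᵥ w) with hr
  set f : ℝ → ℝ := fun θ ↦ Real.cos θ ^ 2 * p + 2 * (Real.cos θ * Real.sin θ) * y +
    Real.sin θ ^ 2 * r with hf_def
  have hf : ∀ θ, f θ =
      (Real.cos θ • u + Real.sin θ • w) ⬝ᵥ (A *ᵥ (Real.cos θ • u + Real.sin θ • w)) := by
    intro θ; rw [rot_quadratic hA]
  have hderiv : _root_.HasDerivAt f (2 * y) 0 := by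
    have hc := Real.hasDerivAt_cos 0
    have hs := Real.hasDerivAt_sin 0
    have h := (((hc.pow 2).mul_const p).add (((hc.mul hs).const_mul 2).mul_const y)).add
      ((hs.pow 2).mul_const r)
    rw [hf_def]
    refine (h.congr_of_eventuallyEq (Filter.Eventually.of_forall fun θ ↦ ?_)).congr_deriv ?_
    · simp
    · simp
  have hmin0 : IsLocalMin f 0 := by
    refine Filter.Eventually.of_forall fun θ ↦ ?_
    have h1 := hmin (Real.cos θ • u + Real.sin θ • w)
      (rot_dotProduct_self hu hw huw _ _ (Real.cos_sq_add_sin_sq θ))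
      (rot_dotProduct_other huv hwv _ _)
    rw [← hf] at h1
    have h0 : f 0 = p := by simp [hf_def]
    rw [h0]; exact h1
  have := hmin0.hasDerivAt_eq_zero hderiv
  linarith

/-- **Hamilton's differential inequality at a minimising pair** (1997, §2.1, proof of Thm. 1.2:
`d/dt (a₁ + a₂) ≥ a₁² + a₂² + 2(a₁ + a₂)a₃ + b₁² + b₂²`, which is `≥ 0` once `a₁ + a₂ ≥ 0`,
"then `a₃ > 0` also"), in Ky Fan form: if the orthonormal pair `(u, v)` minimises
`uᵀAu + vᵀAv` over orthonormal pairs (`A` symmetric) and the minimum is `≥ 0`, then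
`uᵀA'u + vᵀA'v ≥ (uᵀAu + vᵀAv)²` for `A' = A² + B ᵗB + 2A^#`. In the frame `(u, v, u × v)`
the first-order conditions give `A₀₂ = A₁₂ = 0`, `A₂₂ ≥ A₀₀`, and the field is equivariant
(`conj_fieldA`), so `fieldA_diag_sum_ge` applies. [cite: Hamilton1997, §2.1, proof of Thm. 1.2 (p. 7)] -/
theorem fieldA_quadratic_ge {A B : Matrix (Fin 3) (Fin 3) ℝ} (hA : A.IsSymm) {u v : Fin 3 → ℝ}
    (hu : u ⬝ᵥ u = 1) (hv : v ⬝ᵥ v = 1) (huv : u ⬝ᵥ v = 0)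
    (hpos : 0 ≤ u ⬝ᵥ (A *ᵥ u) + v ⬝ᵥ (A *ᵥ v))
    (hmin : ∀ u' v' : Fin 3 → ℝ, u' ⬝ᵥ u' = 1 → v' ⬝ᵥ v' = 1 → u' ⬝ᵥ v' = 0 →
      u ⬝ᵥ (A *ᵥ u) + v ⬝ᵥ (A *ᵥ v) ≤ u' ⬝ᵥ (A *ᵥ u') + v' ⬝ᵥ (A *ᵥ v')) :
    (u ⬝ᵥ (A *ᵥ u) + v ⬝ᵥ (A *ᵥ v)) ^ 2 ≤
      u ⬝ᵥ ((A * A + B * Bᵀ + (2 : ℝ) • A.sharp) *ᵥ u) +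
        v ⬝ᵥ ((A * A + B * Bᵀ + (2 : ℝ) • A.sharp) *ᵥ v) := by
  have hw : (u ⨯₃ v) ⬝ᵥ (u ⨯₃ v) = 1 := dotProduct_cross_self_of_orthonormal hu hv huv
  have huw : u ⬝ᵥ (u ⨯₃ v) = 0 := dot_self_cross u v
  have hvw : v ⬝ᵥ (u ⨯₃ v) = 0 := dot_cross_self u v
  have hwu : (u ⨯₃ v) ⬝ᵥ u = 0 := by rw [dotProduct_comm]; exact huw
  have hwv : (u ⨯₃ v) ⬝ᵥ v = 0 := by rw [dotProduct_comm]; exact hvw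
  have hvu : v ⬝ᵥ u = 0 := by rw [dotProduct_comm]; exact huv
  -- first-order conditions at the minimiser
  have hr0 : u ⬝ᵥ (A *ᵥ u) ≤ (u ⨯₃ v) ⬝ᵥ (A *ᵥ (u ⨯₃ v)) := by
    have := hmin (u ⨯₃ v) v hw hv hwv; linarith
  have hy : u ⬝ᵥ (A *ᵥ (u ⨯₃ v)) = 0 :=
    quad_cross_eq_zero_of_min hA hu hw huw huv hwv fun u' hu' hu'v ↦ by
      have := hmin u' v hu' hv hu'v; linarith
  have hx : v ⬝ᵥ (A *ᵥ (u ⨯₃ v)) = 0 :=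
    quad_cross_eq_zero_of_min hA hv hw hvw hvu hwu fun v' hv' hv'u ↦ by
      have := hmin u v' hu hv' (by rw [dotProduct_comm]; exact hv'u); linarith
  -- rotate to the frame `(u, v, u × v)`
  have hR : Matrix.of ![u, v, u ⨯₃ v] * (Matrix.of ![u, v, u ⨯₃ v])ᵀ = 1 :=
    frame3_mul_transpose hu hv hw huv huw hvw
  have hS : (Matrix.of ![u, v, u ⨯₃ v] * A * (Matrix.of ![u, v, u ⨯₃ v])ᵀ).IsSymm :=
    isSymm_conj hA _
  have key := fieldA_diag_sum_ge (B := Matrix.of ![u, v, u ⨯₃ v] * B) hS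
    (by rw [conj_transpose_apply]; exact hy) (by rw [conj_transpose_apply]; exact hx)
    (by rw [conj_transpose_apply, conj_transpose_apply]; exact hr0)
    (by rw [conj_transpose_apply, conj_transpose_apply]; exact hpos)
  rw [← conj_fieldA hR, conj_transpose_apply, conj_transpose_apply, conj_transpose_apply,
    conj_transpose_apply] at key
  exact key

end HamiltonODE

end Literature.Geometry.Riemannian

end
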